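import Summits.BirchSwinnertonDyer.BirchSwinnertonDyer.Theorems.QuadraticBranchSignedControlPlusEtaNonsurjConjADoorMinusUpper
import Summits.BirchSwinnertonDyer.BirchSwinnertonDyer.Theorems.SignedLowerHalvesSprungLowerDivisibilityAtThreeControlAtT
import Summits.BirchSwinnertonDyer.Rank1Residual.X11b.ChaPairsMinimality
import HarnessLib

/-!
# Route `QuadraticBranchSignedControl` (rung K8, cell `bsd-potss`), residual crux `PlusEtaMainConjectureNonsurj`
# (stmt-BirchSwinnertonDyer-19606): RECORDS THROUGH DOOR L6⁻ — (C1⁺_η) at `p = 5` on the UNCONGRUENT rank-one row u5a:−4 and on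
# four CM rows from TWO class numbers each (`v₅ h(ℚ(P)) ≤ v₅ h(ℚ(x(P)))`), the integral upper inclusion on a fifth
# (seat `bsd-potss-k8eta-c2` g21; census kit j326603 / j326536 / j326613, GRH)

WHAT. p702974 (`EtaConjADoorMinus.conjA_partner_of_relClassNumber`) + p703312 (its fine-road compositions) give (C1⁺_η) on the prime-`L`
rank-`1` shape from the ROW ALONE: named facts `h22 h41 h6273` (Kobayashi 2003) + `hGZK` (`Sel_{5^∞}(W/ℚ)` infinite from `r_an(W) = 1`);
displayed per row: `r_an(W) = 1`, the tower clause, the shape `(L_5⁺(V,η,X)) = (X)` (PARI `λ⁺ = 1, μ⁺ = 0`) and the RELATIVE class-number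
datum: for one `P ∈ W[5] ∖ 0` and every `τ` acting as `−1` on `P`, `v₅ h(ℚ(P)) ≤ v₅ h(ℚ(P)^σ)` (`σ = τ|_{ℚ(P)}`, `ℚ(P)^σ = ℚ(x(P))`;
degrees `24` / `12`; GRH `bnfinit` values in the docstrings). §1 the row-generic form `etaMC_r1_of_relClassNumber`; §2 the UNCONGRUENT row
u5a:−4 = the `5`-partner `W = [0,0,0,−1603875,−781390750]` (`N_W = 17463600 = 2⁴·3⁴·5²·7²·11`, PARI `ellglobalred`) of
the `−4`-twist of `A = [1,−1,1,−4010,98676]` (`j(A)` = the `t = 4/5` point of `X_ns⁺(5)`, k8eta-c2 g19 p666083: NOT `5`-congruent to any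
CM row — the domain of v7's hardest stub `stub_etaMC_nonCM_uncongruent`): `h(ℚ(P)) = 30`, `h(ℚ(x(P))) = 15` (j326536/j326613),
`ε = −1`, `λ⁺ = 1`, `μ⁺ = 0`, `r_an(W) = 1` (g19 etanc j317185ff); the FIRST uncongruent row carried to (C1⁺_η) by name; §3 the CM rank-one
rows 260100e1, 326700fg1, 357075br1 (`h/hx = 45/45, 45/45, 15/15`; Cremona `r_an = 1`; PARI `λ⁺ = 1, μ⁺ = 0`). The two other door-L6⁻
rows of the census are reached by p703312's other shapes and are NOT instantiated here: 378225bk1 (CM rank 0, `60/30`; CM rank-0 shape,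
`+ hPT hmod hKO hS28`, `μ_an`, `L(W,1) ≠ 0`) and 326700y1 (`180/45`, `λ⁺ = 3`: integral Kato inclusion at `η` only).

HONEST FRAMING (cell `bsd-potss`; FULL-BSD rank ≤ 1 programme, HUMAN RULING D-0036/D-0074): per-row RECORDS, CONDITIONAL on the displayed named
facts and per-row inputs; the class numbers are GRH numerics (evidence, not facts); no stub of 19606 is proved by name; the crux stays OPEN;
nothing is booked; `BSD(W,5)` is claimed for no pair. `--supports stmt-BirchSwinnertonDyer-19606`.

References: [Kobayashi2003] §4 (p. 8), Thm. 4.1, Thm. 2.2, Thm. 7.3 i); [CoatesSujatha2005] §3 (A); [GrossZagier1986] Thm. (7.3); [Kolyvagin1990] Thm. A;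
[Cremona1997] Table 1 (labels as listed); [Zywina2015] Thm. 1.4 (the `X_ns⁺(5)` family).
-/

set_option autoImplicit false
set_option linter.dupNamespace false
noncomputable section

open scoped Classical

open CongruenceSubgroup NumberField Field WeierstrassCurve
open Literature.NumberTheory.EllipticCurves Literature.NumberTheory.EllipticCurves.ModularForms
  Literature.NumberTheory.EllipticCurves.Rank1Residual Literature.NumberTheory.EllipticCurves.Rank1Residual.Typed
  Literature.NumberTheory.GaloisRepresentations Literature.NumberTheory.GaloisCohomology
  Literature.NumberTheory.EllipticCurves.GreenbergVatsal2000 ZpExtension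
open Summit.BirchSwinnertonDyer.Rank1Residual.Additive
open Summit.BirchSwinnertonDyer.Rank1Residual.X11b (isElliptic_of_discOf_ne_zero)
open Summit.BirchSwinnertonDyer.BirchSwinnertonDyer.Theorems

namespace Summit.BirchSwinnertonDyer.BirchSwinnertonDyer.Theorems.EtaConjADoorMinusRecords

/-! ## §1 Row-generic form -/

/-- **(C1⁺_η) on a prime-`L` rank-one row from the RELATIVE class-number datum** (row-generic record shape): `W/ℚ` elliptic with
`r_an(W) = 1`, `p ≥ 5`, `V` a globally minimal good `a_p = 0` model of `W^{(p*)}` whose `p`-adic tower is not onto, `(L_p⁺(V,η,X)) = (X)`,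
and one `P ∈ W[p] ∖ 0` with `v_p h(ℚ(P)) ≤ v_p h(ℚ(P)^σ)` for every `τ` acting as `−1` on `P` ⟹ `QuadraticBranchPlusEtaMainConjectureAt V p`.
Named facts `h22 h41 h6273 hGZK`; p703312's `quadraticBranchPlusEtaMainConjectureAt_of_relClassNumber_of_span_eq_span_X` with
`Sel_{p^∞}(W/ℚ)` infinite from `r_an = 1` (`ChromaticCommonZerosControlAtT.not_finite_selmerGroupPInfty_of_analyticRank_eq_one`).
CONDITIONAL; nothing booked. [cite: Kobayashi2003, §4 Even main conjecture (p. 8)] [cite: GrossZagier1986, Thm. (7.3)] [cite: Kolyvagin1990, Thm. A] -/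
theorem etaMC_r1_of_relClassNumber
    (h22 : Kobayashi2003.thm22_etaSignedSelmerDual_finite_torsion)
    (h41 : Kobayashi2003.thm41_plusEtaCharIdeal_dvd)
    (h6273 : Kobayashi2003.thm62_63_73_etaColemanPoitouTate)
    (hGZK : rank_eq_analyticRank_of_analyticRank_le_one)
    (p : ℕ) [Fact p.Prime] [NeZero p] (hp5 : 5 ≤ p)
    (W : WeierstrassCurve ℚ) [W.IsElliptic] (hr : W.analyticRank = 1)
    (V : WeierstrassCurve ℚ) [V.IsElliptic] [V.IsGloballyMinimal] (C : VariableChange ℚ)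
    (hC : C • W.quadraticTwist ((-1) ^ (p / 2) * p) = V)
    (hgood : V.HasGoodReductionAtPrime p) (hap : V.frobeniusTrace p = 0)
    (hns : ¬ ∀ m : ℕ, V.HasSurjectiveModNGaloisRep (p ^ m : ℕ))
    (hX : ∀ {N : ℕ} [NeZero N] {f : CuspForm (Gamma0 N) 2}, IsNewformOf V f →
      ∀ (ϖ : ℚ), (if Even (p / 2) then (ϖ : ℝ) * V.realPeriodRat = plusPeriod f
          else (ϖ : ℝ) * V.imaginaryPeriodRat = minusPeriod f) →
      ∀ (Lη : IwasawaAlgebra p), IsQuadraticBranchPlusLFunction f p ϖ Lη →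
        Ideal.span {Lη} = Ideal.span {(PowerSeries.X : IwasawaAlgebra p)})
    (hP : haveI : NumberField (W.divisionField p) := NumberField.mk
      ∃ P : geomTorsion W (p : ℤ), P ≠ 0 ∧ ∀ τ : absoluteGaloisGroup ℚ, τ • P = -P →
        ∀ K : IntermediateField ℚ (W.divisionField p),
          K = IntermediateField.fixedField
            ((MulAction.stabilizer (absoluteGaloisGroup ℚ) P).map (absRestrictNormalHom (W.divisionField p))) →
        ∀ σ : K ≃ₐ[ℚ] K,
          (∀ x : K, absRestrictNormalHom (W.divisionField p) τ (x : W.divisionField p) =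
            ((σ x : K) : W.divisionField p)) →
          padicValNat p (NumberField.classNumber K) ≤
            padicValNat p (NumberField.classNumber (IntermediateField.fixedField (Subgroup.zpowers σ)))) :
    QuadraticBranchPlusEtaMainConjectureAt V p :=
  EtaConjADoorMinus.quadraticBranchPlusEtaMainConjectureAt_of_relClassNumber_of_span_eq_span_X p V W C h22 h41 h6273 hp5 hC
    hgood hap hns (ChromaticCommonZerosControlAtT.not_finite_selmerGroupPInfty_of_analyticRank_eq_one hGZK W p hr) hX hP

/-! ## §2 The UNCONGRUENT row u5a:−4 -/

/-- The `5`-partner of u5a:−4, `W = [0, 0, 0, −1603875, −781390750]` (non-CM; `j(W) = j(A)`, `A = [1,−1,1,−4010,98676]` the `t = 4/5`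
member of Zywina's `X_ns⁺(5)` family): `Δ ≠ 0` (kernel). [cite: Zywina2015, Thm. 1.4] -/
theorem isElliptic_u5a_m4 : (⟨0, 0, 0, -1603875, -781390750⟩ : WeierstrassCurve ℚ).IsElliptic :=
  isElliptic_of_discOf_ne_zero 0 0 0 (-1603875) (-781390750) (by decide +kernel)

/-- **(C1⁺_η) at `p = 5` for every good `a_5 = 0` model `V` of the `5`-twist of the UNCONGRUENT partner u5a:−4**
(`W = [0,0,0,−1603875,−781390750]`, non-CM, `N_W = 17463600`; k8eta-c2 g19 etanc: `ε(W) = −1`, `r_an(W) = 1`, plus-`η` `(λ, μ) = (1, 0)`;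
census j326536/j326613: `h(ℚ(P)) = 30`, `h(ℚ(x(P))) = 15`, so `v₅ = 1 ≤ 1` — the plain class-number door is void, door L6⁻ passes)
from the ROW ALONE — named facts `h22 h41 h6273 hGZK`; displayed `r_an(W) = 1`, the tower clause, `(L_5⁺(V,η,X)) = (X)`, the relative
class-number datum. `V` runs over the models of `A^{(−1)}`, a row of v7's `stub_etaMC_nonCM_uncongruent` (no CM curve is `5`-congruent to
it, p666083). Instance of `etaMC_r1_of_relClassNumber`. CONDITIONAL; nothing booked. [cite: Kobayashi2003, §4 (p. 8)] [cite: Zywina2015, Thm. 1.4] -/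
theorem etaMC_r1_u5a_m4_5_of_relClassNumber
    (h22 : Kobayashi2003.thm22_etaSignedSelmerDual_finite_torsion)
    (h41 : Kobayashi2003.thm41_plusEtaCharIdeal_dvd)
    (h6273 : Kobayashi2003.thm62_63_73_etaColemanPoitouTate)
    (hGZK : rank_eq_analyticRank_of_analyticRank_le_one) [Fact (5 : ℕ).Prime]
    (W : WeierstrassCurve ℚ) (hW : W = (⟨0, 0, 0, (-1603875), (-781390750)⟩ : WeierstrassCurve ℚ)) (hr : W.analyticRank = 1)
    (V : WeierstrassCurve ℚ) [V.IsElliptic] [V.IsGloballyMinimal] (C : VariableChange ℚ)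
    (hC : C • W.quadraticTwist 5 = V)
    (hgood : V.HasGoodReductionAtPrime 5) (hap : V.frobeniusTrace 5 = 0)
    (hns : ¬ ∀ m : ℕ, V.HasSurjectiveModNGaloisRep (5 ^ m : ℕ))
    (hX : ∀ {N : ℕ} [NeZero N] {f : CuspForm (Gamma0 N) 2}, IsNewformOf V f →
      ∀ (ϖ : ℚ), (if Even (5 / 2) then (ϖ : ℝ) * V.realPeriodRat = plusPeriod f
          else (ϖ : ℝ) * V.imaginaryPeriodRat = minusPeriod f) →
      ∀ (Lη : IwasawaAlgebra 5), IsQuadraticBranchPlusLFunction f 5 ϖ Lη →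
        Ideal.span {Lη} = Ideal.span {(PowerSeries.X : IwasawaAlgebra 5)})
    (hP : haveI : W.IsElliptic := hW ▸ isElliptic_u5a_m4
      haveI : NeZero (5 : ℕ) := ⟨by norm_num⟩
      haveI : NumberField (W.divisionField 5) := NumberField.mk
      ∃ P : geomTorsion W ((5 : ℕ) : ℤ), P ≠ 0 ∧ ∀ τ : absoluteGaloisGroup ℚ, τ • P = -P →
        ∀ K : IntermediateField ℚ (W.divisionField 5),
          K = IntermediateField.fixedField
            ((MulAction.stabilizer (absoluteGaloisGroup ℚ) P).map (absRestrictNormalHom (W.divisionField 5))) →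
        ∀ σ : K ≃ₐ[ℚ] K,
          (∀ x : K, absRestrictNormalHom (W.divisionField 5) τ (x : W.divisionField 5) =
            ((σ x : K) : W.divisionField 5)) →
          padicValNat 5 (NumberField.classNumber K) ≤
            padicValNat 5 (NumberField.classNumber (IntermediateField.fixedField (Subgroup.zpowers σ)))) :
    QuadraticBranchPlusEtaMainConjectureAt V 5 := by
  subst hW
  haveI : (⟨0, 0, 0, (-1603875), (-781390750)⟩ : WeierstrassCurve ℚ).IsElliptic := isElliptic_u5a_m4
  haveI : NeZero (5 : ℕ) := ⟨by norm_num⟩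
  exact etaMC_r1_of_relClassNumber h22 h41 h6273 hGZK 5 (le_refl 5) _ hr V C
    (by rw [show ((-1 : ℚ) ^ ((5 : ℕ) / 2) * ((5 : ℕ) : ℚ)) = 5 by norm_num]; exact hC) hgood hap hns hX hP


/-! ## §3 Three CM rank-one rows decided by door L6⁻ (the plain class-number door is void on each) -/

/-- `260100e1` = `[0, 0, 0, 0, 10440125]` (CM, `j = 0`, `N = 260100`): `Δ ≠ 0` (kernel). [cite: Cremona1997, Table 1 (label 260100e1)] -/
theorem isElliptic_260100e1 : (⟨0, 0, 0, 0, 10440125⟩ : WeierstrassCurve ℚ).IsElliptic :=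
  isElliptic_of_discOf_ne_zero 0 0 0 0 10440125 (by decide +kernel)

/-- **(C1⁺_η) at `p = 5` for every good `a_5 = 0` model `V` of the `5`-twist of `260100e1`** (`W = [0, 0, 0, 0, 10440125]`, CM by `ℤ[ζ₃]`, `N = 260100`,
Cremona `r_an = 1`, `Tam = 4`, `#Ш_an = 1`; PARI plus-`η` `(λ, μ) = (1, 0)` (g20 QP5-ROADS); census j326603: `h(ℚ(P)) = 45`, `h(ℚ(x(P))) = 45`,
`σ₂`-eigenvalues on `Cl(ℚ(P))/5` in `{±1}` — door L6⁻ passes where the plain class-number door is void) from the ROW ALONE — named facts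
`h22 h41 h6273 hGZK`; displayed `r_an(W) = 1`, the tower clause, `(L_5⁺(V,η,X)) = (X)`, the relative class-number datum. Instance of
`etaMC_r1_of_relClassNumber`. CONDITIONAL; nothing booked. [cite: Kobayashi2003, §4 (p. 8)] [cite: Cremona1997, Table 1 (label 260100e1)] -/
theorem etaMC_r1_260100e1_5_of_relClassNumber
    (h22 : Kobayashi2003.thm22_etaSignedSelmerDual_finite_torsion)
    (h41 : Kobayashi2003.thm41_plusEtaCharIdeal_dvd)
    (h6273 : Kobayashi2003.thm62_63_73_etaColemanPoitouTate)
    (hGZK : rank_eq_analyticRank_of_analyticRank_le_one) [Fact (5 : ℕ).Prime]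
    (W : WeierstrassCurve ℚ) (hW : W = (⟨0, 0, 0, 0, 10440125⟩ : WeierstrassCurve ℚ)) (hr : W.analyticRank = 1)
    (V : WeierstrassCurve ℚ) [V.IsElliptic] [V.IsGloballyMinimal] (C : VariableChange ℚ)
    (hC : C • W.quadraticTwist 5 = V)
    (hgood : V.HasGoodReductionAtPrime 5) (hap : V.frobeniusTrace 5 = 0)
    (hns : ¬ ∀ m : ℕ, V.HasSurjectiveModNGaloisRep (5 ^ m : ℕ))
    (hX : ∀ {N : ℕ} [NeZero N] {f : CuspForm (Gamma0 N) 2}, IsNewformOf V f →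
      ∀ (ϖ : ℚ), (if Even (5 / 2) then (ϖ : ℝ) * V.realPeriodRat = plusPeriod f
          else (ϖ : ℝ) * V.imaginaryPeriodRat = minusPeriod f) →
      ∀ (Lη : IwasawaAlgebra 5), IsQuadraticBranchPlusLFunction f 5 ϖ Lη →
        Ideal.span {Lη} = Ideal.span {(PowerSeries.X : IwasawaAlgebra 5)})
    (hP : haveI : W.IsElliptic := hW ▸ isElliptic_260100e1
      haveI : NeZero (5 : ℕ) := ⟨by norm_num⟩
      haveI : NumberField (W.divisionField 5) := NumberField.mk
      ∃ P : geomTorsion W ((5 : ℕ) : ℤ), P ≠ 0 ∧ ∀ τ : absoluteGaloisGroup ℚ, τ • P = -P →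
        ∀ K : IntermediateField ℚ (W.divisionField 5),
          K = IntermediateField.fixedField
            ((MulAction.stabilizer (absoluteGaloisGroup ℚ) P).map (absRestrictNormalHom (W.divisionField 5))) →
        ∀ σ : K ≃ₐ[ℚ] K,
          (∀ x : K, absRestrictNormalHom (W.divisionField 5) τ (x : W.divisionField 5) =
            ((σ x : K) : W.divisionField 5)) →
          padicValNat 5 (NumberField.classNumber K) ≤
            padicValNat 5 (NumberField.classNumber (IntermediateField.fixedField (Subgroup.zpowers σ)))) :
    QuadraticBranchPlusEtaMainConjectureAt V 5 := by
  subst hW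
  haveI : (⟨0, 0, 0, 0, 10440125⟩ : WeierstrassCurve ℚ).IsElliptic := isElliptic_260100e1
  haveI : NeZero (5 : ℕ) := ⟨by norm_num⟩
  exact etaMC_r1_of_relClassNumber h22 h41 h6273 hGZK 5 (le_refl 5) _ hr V C
    (by rw [show ((-1 : ℚ) ^ ((5 : ℕ) / 2) * ((5 : ℕ) : ℚ)) = 5 by norm_num]; exact hC) hgood hap hns hX hP

/-- `326700fg1` = `[0, 0, 0, 0, 60500]` (CM, `j = 0`, `N = 326700`): `Δ ≠ 0` (kernel). [cite: Cremona1997, Table 1 (label 326700fg1)] -/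
theorem isElliptic_326700fg1 : (⟨0, 0, 0, 0, 60500⟩ : WeierstrassCurve ℚ).IsElliptic :=
  isElliptic_of_discOf_ne_zero 0 0 0 0 60500 (by decide +kernel)

/-- **(C1⁺_η) at `p = 5` for every good `a_5 = 0` model `V` of the `5`-twist of `326700fg1`** (`W = [0, 0, 0, 0, 60500]`, CM by `ℤ[ζ₃]`, `N = 326700`,
Cremona `r_an = 1`, `Tam = 6`, `#Ш_an = 1`; PARI plus-`η` `(λ, μ) = (1, 0)` (g20 QP5-ROADS); census j326603: `h(ℚ(P)) = 45`, `h(ℚ(x(P))) = 45`,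
`σ₂`-eigenvalues on `Cl(ℚ(P))/5` in `{±1}` — door L6⁻ passes where the plain class-number door is void) from the ROW ALONE — named facts
`h22 h41 h6273 hGZK`; displayed `r_an(W) = 1`, the tower clause, `(L_5⁺(V,η,X)) = (X)`, the relative class-number datum. Instance of
`etaMC_r1_of_relClassNumber`. CONDITIONAL; nothing booked. [cite: Kobayashi2003, §4 (p. 8)] [cite: Cremona1997, Table 1 (label 326700fg1)] -/
theorem etaMC_r1_326700fg1_5_of_relClassNumber
    (h22 : Kobayashi2003.thm22_etaSignedSelmerDual_finite_torsion)
    (h41 : Kobayashi2003.thm41_plusEtaCharIdeal_dvd)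
    (h6273 : Kobayashi2003.thm62_63_73_etaColemanPoitouTate)
    (hGZK : rank_eq_analyticRank_of_analyticRank_le_one) [Fact (5 : ℕ).Prime]
    (W : WeierstrassCurve ℚ) (hW : W = (⟨0, 0, 0, 0, 60500⟩ : WeierstrassCurve ℚ)) (hr : W.analyticRank = 1)
    (V : WeierstrassCurve ℚ) [V.IsElliptic] [V.IsGloballyMinimal] (C : VariableChange ℚ)
    (hC : C • W.quadraticTwist 5 = V)
    (hgood : V.HasGoodReductionAtPrime 5) (hap : V.frobeniusTrace 5 = 0)
    (hns : ¬ ∀ m : ℕ, V.HasSurjectiveModNGaloisRep (5 ^ m : ℕ))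
    (hX : ∀ {N : ℕ} [NeZero N] {f : CuspForm (Gamma0 N) 2}, IsNewformOf V f →
      ∀ (ϖ : ℚ), (if Even (5 / 2) then (ϖ : ℝ) * V.realPeriodRat = plusPeriod f
          else (ϖ : ℝ) * V.imaginaryPeriodRat = minusPeriod f) →
      ∀ (Lη : IwasawaAlgebra 5), IsQuadraticBranchPlusLFunction f 5 ϖ Lη →
        Ideal.span {Lη} = Ideal.span {(PowerSeries.X : IwasawaAlgebra 5)})
    (hP : haveI : W.IsElliptic := hW ▸ isElliptic_326700fg1
      haveI : NeZero (5 : ℕ) := ⟨by norm_num⟩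
      haveI : NumberField (W.divisionField 5) := NumberField.mk
      ∃ P : geomTorsion W ((5 : ℕ) : ℤ), P ≠ 0 ∧ ∀ τ : absoluteGaloisGroup ℚ, τ • P = -P →
        ∀ K : IntermediateField ℚ (W.divisionField 5),
          K = IntermediateField.fixedField
            ((MulAction.stabilizer (absoluteGaloisGroup ℚ) P).map (absRestrictNormalHom (W.divisionField 5))) →
        ∀ σ : K ≃ₐ[ℚ] K,
          (∀ x : K, absRestrictNormalHom (W.divisionField 5) τ (x : W.divisionField 5) =
            ((σ x : K) : W.divisionField 5)) →
          padicValNat 5 (NumberField.classNumber K) ≤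
            padicValNat 5 (NumberField.classNumber (IntermediateField.fixedField (Subgroup.zpowers σ)))) :
    QuadraticBranchPlusEtaMainConjectureAt V 5 := by
  subst hW
  haveI : (⟨0, 0, 0, 0, 60500⟩ : WeierstrassCurve ℚ).IsElliptic := isElliptic_326700fg1
  haveI : NeZero (5 : ℕ) := ⟨by norm_num⟩
  exact etaMC_r1_of_relClassNumber h22 h41 h6273 hGZK 5 (le_refl 5) _ hr V C
    (by rw [show ((-1 : ℚ) ^ ((5 : ℕ) / 2) * ((5 : ℕ) : ℚ)) = 5 by norm_num]; exact hC) hgood hap hns hX hP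

/-- `357075br1` = `[0, 0, 1, 0, 16531]` (CM, `j = 0`, `N = 357075`): `Δ ≠ 0` (kernel). [cite: Cremona1997, Table 1 (label 357075br1)] -/
theorem isElliptic_357075br1 : (⟨0, 0, 1, 0, 16531⟩ : WeierstrassCurve ℚ).IsElliptic :=
  isElliptic_of_discOf_ne_zero 0 0 1 0 16531 (by decide +kernel)

/-- **(C1⁺_η) at `p = 5` for every good `a_5 = 0` model `V` of the `5`-twist of `357075br1`** (`W = [0, 0, 1, 0, 16531]`, CM by `ℤ[ζ₃]`, `N = 357075`,
Cremona `r_an = 1`, `Tam = 2`, `#Ш_an = 1`; PARI plus-`η` `(λ, μ) = (1, 0)` (g20 QP5-ROADS); census j326603: `h(ℚ(P)) = 15`, `h(ℚ(x(P))) = 15`,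
`σ₂`-eigenvalues on `Cl(ℚ(P))/5` in `{±1}` — door L6⁻ passes where the plain class-number door is void) from the ROW ALONE — named facts
`h22 h41 h6273 hGZK`; displayed `r_an(W) = 1`, the tower clause, `(L_5⁺(V,η,X)) = (X)`, the relative class-number datum. Instance of
`etaMC_r1_of_relClassNumber`. CONDITIONAL; nothing booked. [cite: Kobayashi2003, §4 (p. 8)] [cite: Cremona1997, Table 1 (label 357075br1)] -/
theorem etaMC_r1_357075br1_5_of_relClassNumber
    (h22 : Kobayashi2003.thm22_etaSignedSelmerDual_finite_torsion)
    (h41 : Kobayashi2003.thm41_plusEtaCharIdeal_dvd)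
    (h6273 : Kobayashi2003.thm62_63_73_etaColemanPoitouTate)
    (hGZK : rank_eq_analyticRank_of_analyticRank_le_one) [Fact (5 : ℕ).Prime]
    (W : WeierstrassCurve ℚ) (hW : W = (⟨0, 0, 1, 0, 16531⟩ : WeierstrassCurve ℚ)) (hr : W.analyticRank = 1)
    (V : WeierstrassCurve ℚ) [V.IsElliptic] [V.IsGloballyMinimal] (C : VariableChange ℚ)
    (hC : C • W.quadraticTwist 5 = V)
    (hgood : V.HasGoodReductionAtPrime 5) (hap : V.frobeniusTrace 5 = 0)
    (hns : ¬ ∀ m : ℕ, V.HasSurjectiveModNGaloisRep (5 ^ m : ℕ))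
    (hX : ∀ {N : ℕ} [NeZero N] {f : CuspForm (Gamma0 N) 2}, IsNewformOf V f →
      ∀ (ϖ : ℚ), (if Even (5 / 2) then (ϖ : ℝ) * V.realPeriodRat = plusPeriod f
          else (ϖ : ℝ) * V.imaginaryPeriodRat = minusPeriod f) →
      ∀ (Lη : IwasawaAlgebra 5), IsQuadraticBranchPlusLFunction f 5 ϖ Lη →
        Ideal.span {Lη} = Ideal.span {(PowerSeries.X : IwasawaAlgebra 5)})
    (hP : haveI : W.IsElliptic := hW ▸ isElliptic_357075br1
      haveI : NeZero (5 : ℕ) := ⟨by norm_num⟩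
      haveI : NumberField (W.divisionField 5) := NumberField.mk
      ∃ P : geomTorsion W ((5 : ℕ) : ℤ), P ≠ 0 ∧ ∀ τ : absoluteGaloisGroup ℚ, τ • P = -P →
        ∀ K : IntermediateField ℚ (W.divisionField 5),
          K = IntermediateField.fixedField
            ((MulAction.stabilizer (absoluteGaloisGroup ℚ) P).map (absRestrictNormalHom (W.divisionField 5))) →
        ∀ σ : K ≃ₐ[ℚ] K,
          (∀ x : K, absRestrictNormalHom (W.divisionField 5) τ (x : W.divisionField 5) =
            ((σ x : K) : W.divisionField 5)) →
          padicValNat 5 (NumberField.classNumber K) ≤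
            padicValNat 5 (NumberField.classNumber (IntermediateField.fixedField (Subgroup.zpowers σ)))) :
    QuadraticBranchPlusEtaMainConjectureAt V 5 := by
  subst hW
  haveI : (⟨0, 0, 1, 0, 16531⟩ : WeierstrassCurve ℚ).IsElliptic := isElliptic_357075br1
  haveI : NeZero (5 : ℕ) := ⟨by norm_num⟩
  exact etaMC_r1_of_relClassNumber h22 h41 h6273 hGZK 5 (le_refl 5) _ hr V C
    (by rw [show ((-1 : ℚ) ^ ((5 : ℕ) / 2) * ((5 : ℕ) : ℚ)) = 5 by norm_num]; exact hC) hgood hap hns hX hP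

end Summit.BirchSwinnertonDyer.BirchSwinnertonDyer.Theorems.EtaConjADoorMinusRecords

end
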